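import Literature.NumberTheory.GaloisCohomology.PoitouTateSelmerStructures
import Literature.NumberTheory.GaloisRepresentations.UnramifiedClassesInertia
import Literature.NumberTheory.GaloisRepresentations.GaloisRepUnramifiedProofs
import Literature.NumberTheory.GaloisRepresentations.IntegralGaloisActionProofs
import Literature.NumberTheory.EllipticCurves.H1UnramifiedFiniteProofs
import HarnessLib

/-!
# Finiteness of the Selmer group of a finite Galois module (Selmer structures unramified outside a
# finite set of places) — proofs file

For a number field `K`, a FINITE discrete `Γ_K`-module `M` (`ρ : DiscreteGaloisModule K M`) and a
Selmer structure `𝓕` on `M` (tree `DiscreteGaloisModule.SelmerStructure`: a local condition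
`𝓕_v ≤ H¹(K_v, M)` at every place) which is UNRAMIFIED OUTSIDE a finite set of places `S`
(tree `SelmerStructure.IsUnramifiedOutside`: `𝓕_v = H¹_ur(K_v, M)` at the finite places `v ∉ S`;
Howard 2004 Def. 1.1.10 / Mazur–Rubin 2004 Def. 2.1.1), the Selmer group
`H¹_𝓕(K, M) = {c ∈ H¹(K, M) | loc_v c ∈ 𝓕_v ∀ v}` is FINITE:

* `DiscreteGaloisModule.SelmerStructure.finite_selmerGroup_of_isUnramifiedOutside`.

This is the standard finiteness of Selmer groups of finite Galois modules (Milne, *Arithmetic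
Duality Theorems*, I §6; Mazur–Rubin, *Kolyvagin systems*, §2.1; Silverman, *AEC*, Lemma X.4.3 for
the group `H¹(G_K, M; S)` of classes unramified outside `S`).  In the tree the statement was so
far available only in the `DistribMulAction` dialect of `Literature/NumberTheory/EllipticCurves`
(`finite_h1Unramified_holds` = AEC X.4.3, file `H1UnramifiedFiniteProofs`: `H¹(G_K, M; S)` is
finite, "unramified at `v`" meaning that the restriction to EVERY inertia group `I_𝔓 ≤ Γ_K`,
`𝔓 ∣ v` a prime of `\bar ℤ_K`, vanishes); the `DiscreteGaloisModule`/`SelmerStructure` dialect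
(local conditions inside `H¹(K_v, M)`, `H¹_ur(K_v, M) = ker (H¹(K_v, M) → H¹(K_v^{ur}, M))`) had
only RELATIVE finiteness (`SelmerStructureLocalIndexProofs`).  This file transports X.4.3.

## Proof

Let `Γ = Γ_K`, `c = [φ] ∈ H¹_𝓕(K, M)` (`oneCocycleClass_surjective`) and `v ∉ S` finite.
1. `loc_v c ∈ H¹_ur(K_v, M)` says that `φ ∘ res_v` is principal on the local inertia group
   `I_{K_v} = absInertia K_v`: `φ (res_v σ) = res_v σ • w - w` (`σ ∈ I_{K_v}`)
   (`DiscreteGaloisModule.oneCocycleClass_mem_unramifiedSubgroup_iff_exists`, `map_oneCocycleClass`).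
2. Neukirch II (9.6) in the tree (`GaloisRepUnramifiedProofs`): for the prime `𝔓₀ ∣ v` of `\bar ℤ_K`
   cut out by the chosen embedding `K̄ → \bar K_v` (`exists_ideal_forall_mem_iff_spectralNorm_lt_one`,
   `mem_primesAbove_of_forall_mem_iff`) every `τ ∈ I_{𝔓₀}` is `res_v σ` for some `σ ∈ I_{K_v}`
   (`exists_absGaloisRestrict_eq_of_mem_inertia`); hence `φ` is principal on `I_{𝔓₀}`.
3. Every `𝔓 ∣ v` is `g • 𝔓₀` (`HeightOneSpectrum.exists_smul_eq_of_mem_primesAbove_holds`),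
   `I_{g • 𝔓₀} = g I_{𝔓₀} g⁻¹`, and a crossed homomorphism principal on a set `H` (vector `w`) is
   principal on `g H g⁻¹` (vector `g • w - φ g`; §1, a two-line cocycle identity).
4. The identity compatible pair `(id_Γ, id_M)` maps `H¹(K, M)` (Mathlib's continuous cohomology
   of `ρ.toTopRep`) injectively (`map_one_oneCocycleClass_eq_zero_iff_of_bijective`,
   `oneCocycleClass_eq_zero_iff`) into `H¹(Γ_K, M)` of the `DistribMulAction` `g • m := ρ g m`
   (`discreteTopRep`), and by 3 it maps `H¹_𝓕(K, M)` into `H¹(G_K, M; T)`,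
   `T = {v finite : v ∈ S}`, which is finite by `finite_h1Unramified_holds`.

HONEST FRAMING: textbook finiteness, no new mathematics; no definition, no named fact, no instance
(the `DistribMulAction`/`ContinuousSMul` structures of step 4 are introduced inside the proof with
`letI`), no `sorry`.  Consumer: the level Selmer groups `H¹_F(K, T^{(k)})` of Howard 2004 §1.6
(`Howard2004/DVRLevelSelmerFiniteProofs`).  Nothing about BSD is claimed.

References: [MilneADT2006] J. S. Milne, *Arithmetic Duality Theorems* (2006), I §6;
[SerreGaloisCohomology1997] J.-P. Serre, *Galois Cohomology* (1997), I §2.4, I §5.1;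
[SerreLocalFields1979] J.-P. Serre, *Local Fields* (1979), VII §5 Prop. 3;
[SilvermanAEC2009] J. H. Silverman, *The Arithmetic of Elliptic Curves* (2009), Lemma X.4.3;
[NeukirchANT1999] J. Neukirch, *Algebraic Number Theory* (1999), II §9 Prop. (9.6);
[Howard2004HeegnerKolyvagin] B. Howard, Compositio Math. 140 (2004), Def. 1.1.10.
-/

noncomputable section

open scoped Classical NumberField Pointwise Valued
open CategoryTheory Field IsDedekindDomain NumberField

universe u

namespace Literature.NumberTheory.GaloisCohomology

open Literature.NumberTheory.GaloisRepresentations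
open Literature.NumberTheory.EllipticCurves (discreteTopRep discreteH1 h1Unramified unramifiedKer
  subgroupResKer resHomOfEquivariant mem_h1Unramified_iff finite_h1Unramified_holds)

/-! ## §1 Two cocycle identities for a topological representation -/

section Cocycles

variable {G : Type u} [Group G] [TopologicalSpace G] [IsTopologicalGroup G] (X : TopRep.{u} ℤ G)

omit [IsTopologicalGroup G] in
/-- `φ g⁻¹ = -(g⁻¹ • φ g)` for a continuous crossed homomorphism (1-cocycle) `φ`
(from `φ (g⁻¹ g) = φ 1 = 0`; Serre, *Galois Cohomology*, I §5.1, cocycle identities).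
[cite: SerreGaloisCohomology1997, I §5.1] -/
theorem contOneCocycles_apply_inv (φ : contOneCocycles X) (g : G) :
    φ.1 g⁻¹ = -X.ρ g⁻¹ (φ.1 g) := by
  have h := φ.2 g⁻¹ g
  rw [inv_mul_cancel, contOneCocycles.apply_one] at h
  exact eq_neg_of_add_eq_zero_left h.symm

omit [IsTopologicalGroup G] in
/-- **A crossed homomorphism principal on a set `H` is principal on every conjugate `g H g⁻¹`**:
if `φ τ = τ • w - w` for `τ ∈ H`, then `φ (g τ g⁻¹) = (g τ g⁻¹) • w' - w'` with `w' = g • w - φ g`.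
(The restriction of a cohomology class to a subgroup vanishes iff it vanishes on a conjugate
subgroup: inner automorphisms act trivially on `H¹` — Serre, *Local Fields*, VII §5 Prop. 3;
Neukirch–Schmidt–Wingberg (1.6.3); here in cocycle form for Serre's crossed homomorphisms,
*Galois Cohomology*, I §5.1.) [cite: SerreLocalFields1979, Ch. VII §5 Prop. 3]
[cite: SerreGaloisCohomology1997, I §5.1] -/
theorem contOneCocycles_apply_conj_of_forall_eq (φ : contOneCocycles X) {H : Set G} {w : X}
    (hw : ∀ τ ∈ H, φ.1 τ = X.ρ τ w - w) (g : G) {τ : G} (hτ : τ ∈ H) :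
    φ.1 (g * τ * g⁻¹) = X.ρ (g * τ * g⁻¹) (X.ρ g w - φ.1 g) - (X.ρ g w - φ.1 g) := by
  have h1 : φ.1 (g * τ * g⁻¹) = φ.1 g + X.ρ g (φ.1 τ + X.ρ τ (φ.1 g⁻¹)) := by
    rw [mul_assoc, φ.2 g, φ.2 τ]
  have hgi : ∀ y : X, X.ρ g⁻¹ (X.ρ g y) = y := fun y => by
    rw [← mul_apply_eq_comp, ← map_mul, inv_mul_cancel, map_one, one_apply_eq_self]
  rw [h1, hw τ hτ, contOneCocycles_apply_inv]
  simp only [map_add, map_sub, map_neg, map_mul, mul_apply_eq_comp, hgi]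
  abel

end Cocycles

/-! ## §2 Finiteness of `H¹_𝓕(K, M)` -/

section Finite

variable {K : Type u} [Field K] [NumberField K] {M : Type u} [AddCommGroup M] [TopologicalSpace M]
  [DiscreteTopology M]

/-- **Restriction to a subgroup kills `[φ]` iff `φ` is principal on the subgroup** (discrete module
`M` of a topological group `G`, `DistribMulAction` dialect of `EllipticCurves/GaloisAction`): the
class of a continuous crossed homomorphism `φ` lies in `subgroupResKer M H = ker (H¹(G, M) → H¹(H, M))`
iff `∃ x, ∀ τ ∈ H, φ τ = τ • x - x` (restriction of a cocycle = restriction of the crossed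
homomorphism, and a class vanishes iff its cocycle is principal; Serre, *Galois Cohomology*, I §2.4
(compatible pairs, `Res`) and I §5.1 (`H¹` as crossed homomorphisms modulo principal ones)).
[cite: SerreGaloisCohomology1997, I §2.4 and I §5.1] -/
theorem oneCocycleClass_mem_subgroupResKer_iff {G : Type u} [Group G] [TopologicalSpace G]
    [IsTopologicalGroup G] (M : Type u) [AddCommGroup M] [DistribMulAction G M] [TopologicalSpace M]
    [DiscreteTopology M] (H : Subgroup G) (φ : contOneCocycles (discreteTopRep G M)) :
    oneCocycleClass (discreteTopRep G M) φ ∈ subgroupResKer M H ↔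
      ∃ x : M, ∀ τ ∈ H, φ.1 τ = τ • x - x := by
  unfold subgroupResKer EllipticCurves.resKer
  rw [AddMonoidHom.mem_ker]
  refine (map_one_oneCocycleClass_eq_zero_iff_of_bijective (discreteTopRep G M)
    (discreteTopRep H M) (EllipticCurves.subgroupIncl H)
    (resHomOfEquivariant (EllipticCurves.subgroupIncl H) (AddMonoidHom.id M) fun _ _ => rfl)
    Function.bijective_id φ).trans ?_
  constructor
  · rintro ⟨x, hx⟩
    exact ⟨x, fun τ hτ => hx ⟨τ, hτ⟩⟩
  · rintro ⟨x, hx⟩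
    exact ⟨x, fun l => hx l l.2⟩

/-- **The local condition read on the global inertia groups.**  If `v` is a finite place,
`loc_v [φ] ∈ H¹_ur(K_v, M)` (the tree's local unramified subgroup, restriction to `K_v^{ur}`), then
for EVERY prime `𝔓 ∣ v` of `\bar ℤ_K` the crossed homomorphism `φ` is principal on the inertia
group `I_𝔓 ≤ Γ_K`: `∃ w, ∀ τ ∈ I_𝔓, φ τ = τ • w - w`.  (Neukirch II (9.6): `I_𝔓₀ = res (I_{K_v})`
for the prime `𝔓₀` of the chosen embedding `K̄ → \bar K_v`; the other primes above `v` are its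
`Γ_K`-conjugates.) [cite: NeukirchANT1999, Ch. II §9 Prop. (9.6)] -/
theorem exists_forall_inertia_eq_of_localization_mem_unramifiedSubgroup
    (ρ : DiscreteGaloisModule K M) (φ : contOneCocycles ρ.toTopRep) (v : HeightOneSpectrum (𝓞 K))
    (hloc : galoisCohomology.localization ρ (Sum.inr v) 1 (oneCocycleClass ρ.toTopRep φ) ∈
      DiscreteGaloisModule.unramifiedSubgroup (GaloisRep.toLocal v ρ) 1)
    {𝔓 : Ideal (absIntegers (𝓞 K) K)} (h𝔓 : 𝔓 ∈ v.primesAbove) :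
    ∃ w : M, ∀ τ ∈ 𝔓.inertia (absoluteGaloisGroup K), φ.1 τ = ρ τ w - w := by
  -- Step 1: the local statement on `I_{K_v}`
  have e : galoisCohomology.localization ρ (Sum.inr v) 1 (oneCocycleClass ρ.toTopRep φ) =
      oneCocycleClass (GaloisRep.toLocal v ρ).toTopRep
        (contOneCocycles.pullback (absGaloisRestrict K (v.adicCompletion K))
          (TopRep.ofHom ⟨ContinuousLinearMap.id ℤ M, fun _ => rfl⟩) φ) :=
    map_oneCocycleClass ρ.toTopRep (absGaloisRestrict K (v.adicCompletion K)) _ φ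
  rw [e] at hloc
  obtain ⟨w, hw⟩ :=
    (DiscreteGaloisModule.oneCocycleClass_mem_unramifiedSubgroup_iff_exists
      (GaloisRep.toLocal v ρ) _).mp hloc
  have hw' : ∀ σ ∈ absInertia (v.adicCompletion K),
      φ.1 (absGaloisRestrict K (v.adicCompletion K) σ) =
        ρ (absGaloisRestrict K (v.adicCompletion K) σ) w - w := fun σ hσ => by
    have h := hw σ hσ
    rw [contOneCocycles.pullback_apply] at h
    exact h
  -- Step 2: the prime `𝔓₀` of the embedding and `I_{𝔓₀} = res (I_{K_v})`
  have hwv := adicCompletion_valuation_le_one_iff K v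
  have hO := norm_algebraMap_ringOfIntegers_le_one K v
  have hvn := norm_algebraMap_ringOfIntegers_lt_one_iff K v
  have hd : DenseRange (algebraMap K (v.adicCompletion K)) :=
    IsDedekindDomain.HeightOneSpectrum.denseRange_algebraMap (K := K) (v := v)
  obtain ⟨𝔓₀, h𝔓₀⟩ := exists_ideal_forall_mem_iff_spectralNorm_lt_one K (v.adicCompletion K) hO
  have h𝔓₀v : 𝔓₀ ∈ v.primesAbove := mem_primesAbove_of_forall_mem_iff v hvn 𝔓₀ h𝔓₀
  have h0 : ∀ τ ∈ 𝔓₀.inertia (absoluteGaloisGroup K), φ.1 τ = ρ.toTopRep.ρ τ w - w := by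
    intro τ hτ
    obtain ⟨σ, hσ, rfl⟩ := exists_absGaloisRestrict_eq_of_mem_inertia hwv hd hO
      (exists_norm_algebraMap_adicCompletion_lt_one K v) 𝔓₀ h𝔓₀
      (HeightOneSpectrum.isMaximal_of_mem_primesAbove h𝔓₀v) hτ
    exact hw' σ hσ
  -- Step 3: conjugate to `𝔓 = g • 𝔓₀`
  obtain ⟨g, rfl⟩ := HeightOneSpectrum.exists_smul_eq_of_mem_primesAbove_holds h𝔓₀v h𝔓
  refine ⟨ρ g w - φ.1 g, fun τ hτ => ?_⟩
  have hτ' : g⁻¹ * τ * g ∈ 𝔓₀.inertia (absoluteGaloisGroup K) := by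
    intro x
    have hx : τ • g • x - g • x ∈ g • 𝔓₀ := hτ (g • x)
    rw [Ideal.mem_pointwise_smul_iff_inv_smul_mem, smul_sub] at hx
    simpa [mul_smul] using hx
  have h := contOneCocycles_apply_conj_of_forall_eq ρ.toTopRep φ h0 g hτ'
  have hg : g * (g⁻¹ * τ * g) * g⁻¹ = τ := by group
  rw [hg] at h
  exact h

/-- **The Selmer group of a finite Galois module is finite** (Selmer structure unramified outside a
finite set of places).  For a number field `K`, a finite discrete `Γ_K`-module `M` and a Selmer
structure `𝓕` on `M` with `𝓕_v = H¹_ur(K_v, M)` at every finite place outside the finite set `S`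
(`IsUnramifiedOutside`), `H¹_𝓕(K, M)` is finite.  Milne, *ADT*, I §6 (finiteness of Selmer groups of
finite modules); Mazur–Rubin 2004 §2.1; here DERIVED from Silverman's AEC Lemma X.4.3 in the tree
(`finite_h1Unramified_holds`: `H¹(G_K, M; T)` finite) — `H¹_𝓕(K, M)` embeds into `H¹(G_K, M; T)`,
`T = {v finite | v ∈ S}`, by `exists_forall_inertia_eq_of_localization_mem_unramifiedSubgroup` and
the injectivity of the identity compatible pair on `H¹`.
[cite: MilneADT2006, Ch. I §6] [cite: SilvermanAEC2009, Lemma X.4.3] -/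
theorem _root_.Literature.NumberTheory.GaloisRepresentations.DiscreteGaloisModule.SelmerStructure.finite_selmerGroup_of_isUnramifiedOutside
    [Finite M] {ρ : DiscreteGaloisModule K M} (𝓕 : DiscreteGaloisModule.SelmerStructure ρ)
    {S : Finset (Place K)} (h𝓕 : 𝓕.IsUnramifiedOutside S) : Finite 𝓕.selmerGroup := by
  classical
  letI instAction : DistribMulAction (absoluteGaloisGroup K) M :=
    DistribMulAction.compHom M ρ.toRepresentation
  haveI : ContinuousSMul (absoluteGaloisGroup K) M := ⟨ρ.continuous_smul⟩
  -- the finite set of finite places of `S`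
  let T : Set (HeightOneSpectrum (𝓞 K)) := {v | (Sum.inr v : Place K) ∈ S}
  have hTfin : T.Finite := S.finite_toSet.preimage Sum.inr_injective.injOn
  haveI hfinT : Finite (h1Unramified M T) := finite_h1Unramified_holds K M hTfin
  -- the identity compatible pair `(id_Γ, id_M) : (Γ_K, ρ) → (Γ_K, M with g • m := ρ g m)`
  let f : TopRep.res ((ContinuousMonoidHom.id (absoluteGaloisGroup K) :
      absoluteGaloisGroup K →ₜ* absoluteGaloisGroup K) : absoluteGaloisGroup K →* absoluteGaloisGroup K)
        ρ.toTopRep ⟶ discreteTopRep (absoluteGaloisGroup K) M :=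
    TopRep.ofHom ⟨ContinuousLinearMap.id ℤ M, fun _ => rfl⟩
  have hf : Function.Bijective f.hom := Function.bijective_id
  let Φ : galoisCohomology ρ 1 →+ discreteH1 (absoluteGaloisGroup K) M :=
    (ContinuousCohomology.map (ContinuousMonoidHom.id (absoluteGaloisGroup K)) (X := ρ.toTopRep)
      (Y := discreteTopRep (absoluteGaloisGroup K) M) f 1).hom.toLinearMap.toAddMonoidHom
  have hΦ : ∀ φ : contOneCocycles ρ.toTopRep, Φ (oneCocycleClass ρ.toTopRep φ) =
      oneCocycleClass (discreteTopRep (absoluteGaloisGroup K) M)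
        (contOneCocycles.pullback (ContinuousMonoidHom.id (absoluteGaloisGroup K)) f φ) :=
    fun φ => map_oneCocycleClass ρ.toTopRep (ContinuousMonoidHom.id (absoluteGaloisGroup K)) f φ
  -- `Φ` is injective
  have hinj : ∀ c : galoisCohomology ρ 1, Φ c = 0 → c = 0 := by
    intro c hc
    obtain ⟨φ, rfl⟩ := oneCocycleClass_surjective ρ.toTopRep c
    obtain ⟨x, hx⟩ := (map_one_oneCocycleClass_eq_zero_iff_of_bijective ρ.toTopRep
      (discreteTopRep (absoluteGaloisGroup K) M) (ContinuousMonoidHom.id (absoluteGaloisGroup K))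
      f hf φ).mp hc
    exact (oneCocycleClass_eq_zero_iff ρ.toTopRep φ).mpr ⟨x, fun g => hx g⟩
  -- `Φ` maps Selmer classes to classes unramified outside `T`
  have hmem : ∀ c ∈ 𝓕.selmerGroup, Φ c ∈ h1Unramified M T := by
    intro c hc
    obtain ⟨φ, rfl⟩ := oneCocycleClass_surjective ρ.toTopRep c
    rw [mem_h1Unramified_iff]
    intro v hv 𝔓 h𝔓
    -- the local condition at `v ∉ S` is the unramified one
    have hloc : galoisCohomology.localization ρ (Sum.inr v) 1 (oneCocycleClass ρ.toTopRep φ) ∈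
        DiscreteGaloisModule.unramifiedSubgroup (GaloisRep.toLocal v ρ) 1 := by
      have h := (DiscreteGaloisModule.SelmerStructure.mem_selmerGroup_iff 𝓕 _).mp hc (Sum.inr v)
      rw [h𝓕.2 v hv] at h
      exact h
    obtain ⟨w, hw⟩ :=
      exists_forall_inertia_eq_of_localization_mem_unramifiedSubgroup ρ φ v hloc h𝔓
    -- membership in `unramifiedKer M 𝔓 = ker (H¹(Γ_K, M) → H¹(I_𝔓, M))`
    unfold unramifiedKer
    rw [hΦ]
    exact (oneCocycleClass_mem_subgroupResKer_iff M _ _).mpr ⟨w, fun τ hτ => hw τ hτ⟩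
  -- conclusion: `H¹_𝓕(K, M)` embeds into the finite group `H¹(G_K, M; T)`
  refine Finite.of_injective
    (fun c : 𝓕.selmerGroup => (⟨Φ c, hmem c c.2⟩ : h1Unramified M T)) fun a b hab => ?_
  have h0 : Φ ((a : galoisCohomology ρ 1) - b) = 0 := by
    rw [map_sub, sub_eq_zero]
    exact congrArg Subtype.val hab
  exact Subtype.ext (sub_eq_zero.mp (hinj _ h0))

end Finite

end Literature.NumberTheory.GaloisCohomology
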